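import Mathlib

/-!
# The ray-restriction theorem (abstract form) — the theorem
(blind cell PercRepro2, mine-1 g46; MINE1-UNIONROW-K3.md §14.1 / §14.4.)

Setting: polynomials in the masses `MvPolynomial σ ℚ`; a weight `w : σ → ℕ` (the cells with `w ≠ 0` are the empty cells
`Z₀` of the base point); a base point `x` (zero on `Z₀`, positive elsewhere) with `V(x) = 0` and a direction `y`
(positive on `Z₀`, zero elsewhere); the expansion `phi x y w p = p(x + ε^w y) ∈ ℚ[ε]` and its coefficients
`(phi x y w p).coeff k` = the weighted-degree-`k` part of `p` evaluated at `x + y`.  The facts `slack j` have orders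
`dd j` along the curve (the first coefficient that does not vanish is positive — the RAY CONDITION, automatic when the
curve stays inside the PA-feasible set), and a WITNESS curve `(x', y')` of the same shape has `V(x') < 0` and
nonnegative coefficients of every fact up to its order.  Then no identity `ℓ·V = Σ_j q_j·slack_j + R` with
nonnegative-coefficient polynomials `ℓ ≠ 0`, `q_j`, `R` (of any degree) exists.
-/

namespace Summit.Ventures.PercRepro2.UnionRowRayRestriction

open MvPolynomial

variable {σ : Type*}

/-- the ε-expansion of a polynomial along the weighted curve `x + ε^w y`: `p ↦ p(x + ε^w y) ∈ ℚ[ε]` -/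
noncomputable def phi (x y : σ → ℚ) (w : σ → ℕ) : MvPolynomial σ ℚ →+* Polynomial ℚ :=
  eval₂Hom Polynomial.C (fun v => Polynomial.C (x v) + Polynomial.C (y v) * Polynomial.X ^ (w v))

/-- the weighted degree of an exponent vector -/
def wdeg [Fintype σ] (w : σ → ℕ) (d : σ →₀ ℕ) : ℕ := ∑ v, w v * d v

/-- one factor of the expansion of a monomial, when `x` vanishes where `w ≠ 0` and `y` where `w = 0` -/
theorem phi_factor {x y : σ → ℚ} {w : σ → ℕ} (hx : ∀ v, w v ≠ 0 → x v = 0) (hy : ∀ v, w v = 0 → y v = 0)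
    (v : σ) (e : ℕ) :
    (Polynomial.C (x v) + Polynomial.C (y v) * Polynomial.X ^ (w v)) ^ e
      = Polynomial.C ((x v + y v) ^ e) * Polynomial.X ^ (w v * e) := by
  by_cases hw : w v = 0
  · rw [hw, hy v hw]; simp
  · rw [hx v hw]; simp [mul_pow, ← pow_mul]

variable [Fintype σ]

/-- the expansion of a monomial: the coefficient times `ε^{wdeg}` -/
theorem phi_monomial {x y : σ → ℚ} {w : σ → ℕ} (hx : ∀ v, w v ≠ 0 → x v = 0) (hy : ∀ v, w v = 0 → y v = 0)
    (d : σ →₀ ℕ) (c : ℚ) :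
    phi x y w (monomial d c)
      = Polynomial.C (c * ∏ v, (x v + y v) ^ d v) * Polynomial.X ^ (wdeg w d) := by
  unfold phi
  rw [coe_eval₂Hom, eval₂_monomial]
  rw [Finsupp.prod_fintype _ _ (fun _ => pow_zero _)]
  simp_rw [phi_factor hx hy]
  rw [Finset.prod_mul_distrib, ← map_prod, Finset.prod_pow_eq_pow_sum]
  unfold wdeg
  rw [map_mul, mul_assoc]

/-- the `ε^k`-coefficient of the expansion: the sum over the monomials of weighted degree `k` -/
theorem coeff_phi {x y : σ → ℚ} {w : σ → ℕ} (hx : ∀ v, w v ≠ 0 → x v = 0) (hy : ∀ v, w v = 0 → y v = 0)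
    (p : MvPolynomial σ ℚ) (k : ℕ) :
    (phi x y w p).coeff k
      = ∑ d ∈ p.support, if wdeg w d = k then p.coeff d * ∏ v, (x v + y v) ^ d v else 0 := by
  conv_lhs => rw [p.as_sum]
  rw [map_sum, Polynomial.finsetSum_coeff]
  refine Finset.sum_congr rfl fun d _ => ?_
  rw [phi_monomial hx hy, Polynomial.coeff_C_mul_X_pow]
  by_cases h : wdeg w d = k
  · rw [if_pos h.symm, if_pos h]
  · rw [if_neg (fun h' => h h'.symm), if_neg h]

/-- a coefficient of the expansion is nonnegative at a nonnegative point for a nonnegative-coefficient polynomial -/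
theorem coeff_phi_nonneg {x y : σ → ℚ} {w : σ → ℕ} (hx : ∀ v, w v ≠ 0 → x v = 0) (hy : ∀ v, w v = 0 → y v = 0)
    (hpos : ∀ v, 0 ≤ x v + y v) {p : MvPolynomial σ ℚ} (hp : ∀ d, 0 ≤ p.coeff d) (k : ℕ) :
    0 ≤ (phi x y w p).coeff k := by
  rw [coeff_phi hx hy]
  refine Finset.sum_nonneg fun d _ => ?_
  split_ifs
  · exact mul_nonneg (hp d) (Finset.prod_nonneg fun v _ => pow_nonneg (hpos v) _)
  · exact le_rfl

/-- `cz w p k`: every coefficient of `p` of weighted degree `k` vanishes -/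
def cz (w : σ → ℕ) (p : MvPolynomial σ ℚ) (k : ℕ) : Prop := ∀ d, wdeg w d = k → p.coeff d = 0

/-- if the `ε^k`-coefficient vanishes at a POSITIVE point, every coefficient of weighted degree `k` vanishes -/
theorem cz_of_coeff_phi_eq_zero {x y : σ → ℚ} {w : σ → ℕ} (hx : ∀ v, w v ≠ 0 → x v = 0)
    (hy : ∀ v, w v = 0 → y v = 0) (hpos : ∀ v, 0 < x v + y v) {p : MvPolynomial σ ℚ}
    (hp : ∀ d, 0 ≤ p.coeff d) {k : ℕ} (h0 : (phi x y w p).coeff k = 0) : cz w p k := by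
  intro d hd
  rw [coeff_phi hx hy] at h0
  have hterm : ∀ e ∈ p.support, 0 ≤ (if wdeg w e = k then p.coeff e * ∏ v, (x v + y v) ^ e v else 0) := by
    intro e _
    split_ifs
    · exact mul_nonneg (hp e) (Finset.prod_nonneg fun v _ => pow_nonneg (hpos v).le _)
    · exact le_rfl
  rw [Finset.sum_eq_zero_iff_of_nonneg hterm] at h0
  by_cases hmem : d ∈ p.support
  · have := h0 d hmem
    rw [if_pos hd] at this
    have hprod : 0 < ∏ v, (x v + y v) ^ d v := Finset.prod_pos fun v _ => pow_pos (hpos v) _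
    exact (mul_eq_zero.mp this).resolve_right hprod.ne'
  · simpa using hmem

/-- conversely, if every coefficient of weighted degree `k` vanishes, so does the `ε^k`-coefficient at ANY curve -/
theorem coeff_phi_eq_zero_of_cz {x y : σ → ℚ} {w : σ → ℕ} (hx : ∀ v, w v ≠ 0 → x v = 0) (hy : ∀ v, w v = 0 → y v = 0)
    {p : MvPolynomial σ ℚ} {k : ℕ} (h : cz w p k) : (phi x y w p).coeff k = 0 := by
  rw [coeff_phi hx hy]
  refine Finset.sum_eq_zero fun d _ => ?_
  split_ifs with hd
  · rw [h d hd, zero_mul]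
  · rfl

/-- a polynomial all of whose weighted-degree parts vanish is zero -/
theorem eq_zero_of_cz {w : σ → ℕ} {p : MvPolynomial σ ℚ} (h : ∀ k, cz w p k) : p = 0 := by
  ext d
  rw [coeff_zero]
  exact h (wdeg w d) d rfl

/-- the constant term of the expansion is the value at the base point `x` -/
theorem coeff_zero_phi {x y : σ → ℚ} {w : σ → ℕ} (hx : ∀ v, w v ≠ 0 → x v = 0) (hy : ∀ v, w v = 0 → y v = 0)
    (p : MvPolynomial σ ℚ) : (phi x y w p).coeff 0 = eval x p := by
  rw [coeff_phi hx hy, eval_eq']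
  refine Finset.sum_congr rfl fun d _ => ?_
  by_cases hd : wdeg w d = 0
  · rw [if_pos hd]
    congr 1
    refine Finset.prod_congr rfl fun v _ => ?_
    by_cases hw : w v = 0
    · rw [hy v hw, add_zero]
    · have hdv : d v = 0 := by
        unfold wdeg at hd
        have := (Finset.sum_eq_zero_iff_of_nonneg (fun v _ => Nat.zero_le (w v * d v))).mp hd v (Finset.mem_univ v)
        exact (Nat.mul_eq_zero.mp this).resolve_left hw
      rw [hdv, pow_zero, pow_zero]
  · rw [if_neg hd]
    have : ∃ v, w v ≠ 0 ∧ d v ≠ 0 := by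
      by_contra hcon
      push Not at hcon
      apply hd
      unfold wdeg
      exact Finset.sum_eq_zero fun v _ => by
        by_cases hw : w v = 0
        · rw [hw, zero_mul]
        · rw [hcon v hw, mul_zero]
    obtain ⟨v, hw, hdv⟩ := this
    symm
    rw [mul_eq_zero]
    right
    exact Finset.prod_eq_zero (Finset.mem_univ v) (by rw [hx v hw]; exact zero_pow hdv)

omit [Fintype σ] in
/-- the level-`k` coefficient of a product: the Cauchy formula -/
theorem coeff_phi_mul (x y : σ → ℚ) (w : σ → ℕ) (p q : MvPolynomial σ ℚ) (k : ℕ) :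
    (phi x y w (p * q)).coeff k
      = ∑ ij ∈ Finset.HasAntidiagonal.antidiagonal k, (phi x y w p).coeff ij.1 * (phi x y w q).coeff ij.2 := by
  rw [map_mul, Polynomial.coeff_mul]

/-- the level-`k` coefficient of `ℓ·V` when the lower parts of `ℓ` vanish: `ℓ^{(k)}(x+y)·V(x)` -/
theorem coeff_phi_mul_of_cz {x y : σ → ℚ} {w : σ → ℕ} (hx : ∀ v, w v ≠ 0 → x v = 0) (hy : ∀ v, w v = 0 → y v = 0)
    {ℓ V : MvPolynomial σ ℚ} {k : ℕ} (hℓ : ∀ i < k, cz w ℓ i) :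
    (phi x y w (ℓ * V)).coeff k = (phi x y w ℓ).coeff k * eval x V := by
  rw [coeff_phi_mul, ← coeff_zero_phi hx hy V]
  rw [Finset.sum_eq_single (k, 0)]
  · intro ij hij hne
    rw [Finset.HasAntidiagonal.mem_antidiagonal] at hij
    have hlt : ij.1 < k := by
      rcases Nat.lt_or_ge ij.1 k with h | h
      · exact h
      · exfalso
        apply hne
        have h1 : ij.1 = k := le_antisymm (by omega) h
        have h2 : ij.2 = 0 := by omega
        exact Prod.ext h1 h2
    rw [coeff_phi_eq_zero_of_cz hx hy (hℓ ij.1 hlt), zero_mul]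
  · intro h
    exact absurd (Finset.HasAntidiagonal.mem_antidiagonal.mpr (by simp)) h

variable {ι : Type*} [Fintype ι]

/-- THE RAY-RESTRICTION THEOREM (abstract form).  `w` marks the empty cells `Z₀` of the base point `x`; `y` is the
direction (positive on `Z₀`); `V(x) = 0`; every fact `slack j` has order `dd j` along the curve with a positive
leading coefficient, or vanishes along it entirely (the RAY CONDITION); the witness curve `(x', y')` has
`V(x') < 0` and nonnegative coefficients of every fact below its order (and of every coefficient of the facts
vanishing along the base curve).  Then an identity `ℓ·V = Σ_j q_j·slack_j + R` with nonnegative-coefficient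
`ℓ, q_j, R` forces `ℓ = 0`. -/
theorem ray_restriction
    {x y x' y' : σ → ℚ} {w : σ → ℕ}
    (hx : ∀ v, w v ≠ 0 → x v = 0) (hy : ∀ v, w v = 0 → y v = 0) (hpos : ∀ v, 0 < x v + y v)
    (hx' : ∀ v, w v ≠ 0 → x' v = 0) (hy' : ∀ v, w v = 0 → y' v = 0) (hpos' : ∀ v, 0 < x' v + y' v)
    {V : MvPolynomial σ ℚ} (hV : eval x V = 0) (hV' : eval x' V < 0)
    {slack : ι → MvPolynomial σ ℚ} {dd : ι → ℕ}
    (hray0 : ∀ j, ∀ b < dd j, (phi x y w (slack j)).coeff b = 0)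
    (hrayd : ∀ j, 0 < (phi x y w (slack j)).coeff (dd j) ∨ ∀ b, (phi x y w (slack j)).coeff b = 0)
    (hwit : ∀ j b, (b < dd j ∨ ∀ b', (phi x y w (slack j)).coeff b' = 0) →
      0 ≤ (phi x' y' w (slack j)).coeff b)
    {ℓ R : MvPolynomial σ ℚ} {q : ι → MvPolynomial σ ℚ}
    (hℓ : ∀ d, 0 ≤ ℓ.coeff d) (hR : ∀ d, 0 ≤ R.coeff d) (hq : ∀ j d, 0 ≤ (q j).coeff d)
    (hid : ℓ * V = ∑ j, q j * slack j + R) : ℓ = 0 := by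
  classical
  -- the invariant T k
  let T : ℕ → Prop := fun k => (∀ i < k, cz w ℓ i) ∧ (∀ i < k, cz w R i) ∧
    (∀ j, ¬ (∀ b, (phi x y w (slack j)).coeff b = 0) → ∀ a, a + dd j < k → cz w (q j) a)
  have hT : ∀ k, T k := by
    intro k
    induction k with
    | zero => exact ⟨fun i hi => absurd hi (Nat.not_lt_zero i), fun i hi => absurd hi (Nat.not_lt_zero i),
        fun j _ a ha => absurd ha (Nat.not_lt_zero _)⟩
    | succ k ih =>
      obtain ⟨ihℓ, ihR, ihq⟩ := ih
      -- STEP A: level k at the base curve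
      have hA : (phi x y w (ℓ * V)).coeff k = (phi x y w (∑ j, q j * slack j + R)).coeff k := by rw [hid]
      rw [coeff_phi_mul_of_cz hx hy ihℓ, hV, mul_zero, map_add, map_sum, Polynomial.coeff_add,
        Polynomial.finsetSum_coeff] at hA
      simp_rw [coeff_phi_mul] at hA
      -- every term is nonnegative
      have hterm : ∀ j, ∀ ij ∈ Finset.HasAntidiagonal.antidiagonal k,
          0 ≤ (phi x y w (q j)).coeff ij.1 * (phi x y w (slack j)).coeff ij.2 := by
        intro j ij hij
        rw [Finset.HasAntidiagonal.mem_antidiagonal] at hij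
        have hq0 : 0 ≤ (phi x y w (q j)).coeff ij.1 := coeff_phi_nonneg hx hy (fun v => (hpos v).le) (hq j) _
        rcases Nat.lt_trichotomy ij.2 (dd j) with hb | hb | hb
        · rw [hray0 j ij.2 hb, mul_zero]
        · rw [hb]
          rcases hrayd j with h | h
          · exact mul_nonneg hq0 h.le
          · rw [h, mul_zero]
        · by_cases hall : ∀ b, (phi x y w (slack j)).coeff b = 0
          · rw [hall, mul_zero]
          · have : cz w (q j) ij.1 := ihq j hall ij.1 (by omega)
            rw [coeff_phi_eq_zero_of_cz hx hy this, zero_mul]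
      have hsumnn : ∀ j ∈ (Finset.univ : Finset ι), 0 ≤ ∑ ij ∈ Finset.HasAntidiagonal.antidiagonal k,
          (phi x y w (q j)).coeff ij.1 * (phi x y w (slack j)).coeff ij.2 :=
        fun j _ => Finset.sum_nonneg (hterm j)
      have hRnn : 0 ≤ (phi x y w R).coeff k := coeff_phi_nonneg hx hy (fun v => (hpos v).le) hR _
      have hRk : (phi x y w R).coeff k = 0 := by
        have := Finset.sum_nonneg hsumnn
        linarith
      have hSk : ∀ j ∈ (Finset.univ : Finset ι), ∑ ij ∈ Finset.HasAntidiagonal.antidiagonal k,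
          (phi x y w (q j)).coeff ij.1 * (phi x y w (slack j)).coeff ij.2 = 0 := by
        rw [← Finset.sum_eq_zero_iff_of_nonneg hsumnn]
        linarith
      have hczR : cz w R k := cz_of_coeff_phi_eq_zero hx hy hpos hR hRk
      -- the multipliers of the facts with order ≤ k vanish at level k − dd j
      have hczq : ∀ j, ¬ (∀ b, (phi x y w (slack j)).coeff b = 0) → ∀ a, a + dd j ≤ k → cz w (q j) a := by
        intro j hall a ha
        rcases Nat.lt_or_ge (a + dd j) k with hlt | hge
        · exact ihq j hall a hlt
        · have hak : a + dd j = k := le_antisymm ha hge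
          have hmem : (a, dd j) ∈ Finset.HasAntidiagonal.antidiagonal k := Finset.HasAntidiagonal.mem_antidiagonal.mpr hak
          have h0 := (Finset.sum_eq_zero_iff_of_nonneg (hterm j)).mp (hSk j (Finset.mem_univ j)) (a, dd j) hmem
          have hd : 0 < (phi x y w (slack j)).coeff (dd j) := (hrayd j).resolve_right hall
          have hq0 : (phi x y w (q j)).coeff a = 0 := (mul_eq_zero.mp h0).resolve_right hd.ne'
          exact cz_of_coeff_phi_eq_zero hx hy hpos (hq j) hq0
      -- STEP B: level k at the witness curve
      have hB : (phi x' y' w (ℓ * V)).coeff k = (phi x' y' w (∑ j, q j * slack j + R)).coeff k := by rw [hid]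
      rw [coeff_phi_mul_of_cz hx' hy' ihℓ, map_add, map_sum, Polynomial.coeff_add,
        Polynomial.finsetSum_coeff, coeff_phi_eq_zero_of_cz hx' hy' hczR, add_zero] at hB
      simp_rw [coeff_phi_mul] at hB
      have hterm' : ∀ j, ∀ ij ∈ Finset.HasAntidiagonal.antidiagonal k,
          0 ≤ (phi x' y' w (q j)).coeff ij.1 * (phi x' y' w (slack j)).coeff ij.2 := by
        intro j ij hij
        rw [Finset.HasAntidiagonal.mem_antidiagonal] at hij
        have hq0 : 0 ≤ (phi x' y' w (q j)).coeff ij.1 := coeff_phi_nonneg hx' hy' (fun v => (hpos' v).le) (hq j) _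
        by_cases hlive : ij.2 < dd j ∨ ∀ b', (phi x y w (slack j)).coeff b' = 0
        · exact mul_nonneg hq0 (hwit j ij.2 hlive)
        · have h1 : dd j ≤ ij.2 := Nat.le_of_not_lt fun h => hlive (Or.inl h)
          have h2 : ¬ ∀ b', (phi x y w (slack j)).coeff b' = 0 := fun h => hlive (Or.inr h)
          have : cz w (q j) ij.1 := hczq j h2 ij.1 (by omega)
          rw [coeff_phi_eq_zero_of_cz hx' hy' this, zero_mul]
      have hrhs : 0 ≤ ∑ j, ∑ ij ∈ Finset.HasAntidiagonal.antidiagonal k,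
          (phi x' y' w (q j)).coeff ij.1 * (phi x' y' w (slack j)).coeff ij.2 :=
        Finset.sum_nonneg fun j _ => Finset.sum_nonneg (hterm' j)
      rw [← hB] at hrhs
      have hℓk : 0 ≤ (phi x' y' w ℓ).coeff k := coeff_phi_nonneg hx' hy' (fun v => (hpos' v).le) hℓ _
      have hℓk0 : (phi x' y' w ℓ).coeff k = 0 := by
        rcases hℓk.lt_or_eq with h | h
        · exfalso
          have : (phi x' y' w ℓ).coeff k * eval x' V < 0 := mul_neg_of_pos_of_neg h hV'
          linarith
        · exact h.symm
      have hczℓ : cz w ℓ k := cz_of_coeff_phi_eq_zero hx' hy' hpos' hℓ hℓk0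
      refine ⟨?_, ?_, ?_⟩
      · intro i hi
        rcases Nat.lt_or_ge i k with h | h
        · exact ihℓ i h
        · have : i = k := by omega
          rw [this]; exact hczℓ
      · intro i hi
        rcases Nat.lt_or_ge i k with h | h
        · exact ihR i h
        · have : i = k := by omega
          rw [this]; exact hczR
      · intro j hall a ha
        exact hczq j hall a (by omega)
  exact eq_zero_of_cz fun k => (hT (k + 1)).1 k (Nat.lt_succ_self k)

end Summit.Ventures.PercRepro2.UnionRowRayRestriction
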